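import Mathlib
import Summits.PneNP.PneNP.Theorems.OverlapGapAlgebraSearchHardWindowThresholdRung
import Literature.Computability.Complexity.RandomKSatLowDegreeHardness

/-!
# Route OverlapGapAlgebra, crux `SearchHardWindow` (stmt-PneNP-2460): corollaries of the
# threshold-statistic rung — majority vote, and linear threshold gates over the instance bits

Two named members of the class of `thresholdStatisticRung` (`…ThresholdRung.lean`), unconditional:

* `majorityVoteFails` — the **majority-polarity assignment** (set `x_v` true iff the literal `x_v`
  occurs more often than `x̄_v` in the formula) satisfies `Φ ∼ F_k(n, ⌊α_k n⌋)` with probability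
  `→ 0` for every `k ≥ k₀` (weights `±[literal = (v, ·)]`, threshold `0`).
* `bitThresholdRung` — **linear threshold functions over the bit encoding**: with `n = 2^j` and the
  instance presented as its `m·k·(j+1)` bits (`litArrayOfBits`, the encoding of the AC⁰ /
  decision-tree / formula rungs), every family of LTFs `σ_v(x) = [θ_v < Σ_e c_v e · x_e]`, one per
  output variable, with arbitrary real weights, outputs a satisfying assignment for at most
  `ε · 2^{m k (j+1)}` inputs, eventually — a linear form in the bits of slot `(a, b)` is a function
  of the literal `Φ a b` (`bitsOfLitArray_eq_of_slot_eq`), so these maps are threshold statistics.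
  (Peres's theorem is exactly the statement that this class is uniformly noise-stable; unbounded
  weights put it outside the sub-quadratic formula rung `formulaRung`.)

No new definitions; axioms standard. References: Y. Peres, arXiv:math/0412377 [Peres2004];
R. O'Donnell 2014, §5.5 [ODonnell2014].
-/

set_option linter.dupNamespace false -- `Summit.PneNP.PneNP.…`: summit = sub-problem (D-0017)

noncomputable section

namespace Summit.PneNP.PneNP.Theorems

open Finset Filter
open Literature.Computability.Complexity
open scoped Classical

/-- **The majority-polarity vote fails (unconditional).** For `k ≥ k₀` and `ε > 0`, eventually in
`n`, with `m = ⌊5 · 2^k log k / k · n⌋`: the assignment "`x_v` true iff the literal `(v, true)`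
occupies more of the `m k` literal slots of `Φ` than `(v, false)`" satisfies `Φ` for at most
`ε · #instances` instances of `F_k(n, m)`. [cite: Peres2004, Thm. 1] -/
theorem majorityVoteFails :
    ∃ k₀ : ℕ, ∀ k : ℕ, k₀ ≤ k → ∀ ε : ℝ, 0 < ε →
      ∀ᶠ n : ℕ in atTop, ∀ m : ℕ, m = ⌊5 * 2 ^ k * Real.log k / k * n⌋₊ →
        ((univ.filter fun Φ : Fin m → Fin k → Fin n × Bool =>
            ∀ i : Fin m, ∃ j : Fin k,
              decide ((univ.filter fun p : Fin m × Fin k => Φ p.1 p.2 = ((Φ i j).1, false)).card <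
                (univ.filter fun p : Fin m × Fin k => Φ p.1 p.2 = ((Φ i j).1, true)).card)
              = (Φ i j).2).card : ℝ)
          ≤ ε * Fintype.card (Fin m → Fin k → Fin n × Bool) := by
  obtain ⟨k₀, hk₀⟩ := thresholdStatisticRung
  refine ⟨k₀, fun k hk ε hε => ?_⟩
  filter_upwards [hk₀ k hk ε hε] with n hn m hm
  -- weights `+1` on `(v, true)`, `-1` on `(v, false)`, threshold `0`
  set w : Fin n → Fin m → Fin k → Fin n × Bool → ℝ := fun v _ _ ℓ =>
    (if ℓ = (v, true) then (1 : ℝ) else 0) - (if ℓ = (v, false) then (1 : ℝ) else 0) with hw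
  set g : Fin n → (Fin m → Fin k → Fin n × Bool) → Bool := fun v Φ =>
    decide ((univ.filter fun p : Fin m × Fin k => Φ p.1 p.2 = (v, false)).card <
      (univ.filter fun p : Fin m × Fin k => Φ p.1 p.2 = (v, true)).card) with hg
  have hgw : ∀ v Φ, g v Φ = decide ((fun _ => (0 : ℝ)) v < ∑ i, ∑ j, w v i j (Φ i j)) := by
    intro v Φ
    have hsum : (∑ i, ∑ j, w v i j (Φ i j)) =
        ((univ.filter fun p : Fin m × Fin k => Φ p.1 p.2 = (v, true)).card : ℝ) -
        ((univ.filter fun p : Fin m × Fin k => Φ p.1 p.2 = (v, false)).card : ℝ) := by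
      simp only [hw]
      rw [← Fintype.sum_prod_type', sum_sub_distrib, sum_boole, sum_boole]
    simp only [hg]
    refine decide_eq_decide.mpr ?_
    rw [hsum, sub_pos, Nat.cast_lt]
  exact hn m hm w (fun _ => 0) g hgw

/-- **Linear threshold gates over the instance bits fail (unconditional).** For `k ≥ k₀` and
`ε > 0`, eventually in `n`: if `n = 2^j` and `m = ⌊5 · 2^k log k / k · n⌋`, then for every family
of real weights `c v e` and thresholds `θ v` (one linear threshold function of the `m k (j+1)`
instance bits per output variable `v`), the assignment `σ_v(x) = [θ v < Σ_e c v e · x_e]` satisfies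
the decoded instance `litArrayOfBits x ∼ F_k(2^j, m)` for at most `ε · 2^{m k (j+1)}` inputs `x`.
[cite: Peres2004, Thm. 1] -/
theorem bitThresholdRung :
    ∃ k₀ : ℕ, ∀ k : ℕ, k₀ ≤ k → ∀ ε : ℝ, 0 < ε →
      ∀ᶠ n : ℕ in atTop, ∀ j m : ℕ, n = 2 ^ j → m = ⌊5 * 2 ^ k * Real.log k / k * n⌋₊ →
        ∀ (c : Fin (2 ^ j) → Fin (m * k * (j + 1)) → ℝ) (θ : Fin (2 ^ j) → ℝ),
          ((univ.filter fun x : Fin (m * k * (j + 1)) → Bool =>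
              ∀ i : Fin m, ∃ j' : Fin k,
                decide (θ (litArrayOfBits m k j x i j').1 <
                  ∑ e, c (litArrayOfBits m k j x i j').1 e * (if x e then (1 : ℝ) else 0))
                = (litArrayOfBits m k j x i j').2).card : ℝ)
            ≤ ε * 2 ^ (m * k * (j + 1)) := by
  obtain ⟨k₀, hk₀⟩ := thresholdStatisticRung
  refine ⟨k₀, fun k hk ε hε => ?_⟩
  filter_upwards [hk₀ k hk ε hε] with n hn j m hnj hm c θ
  subst hnj
  -- slot weights: the part of the linear form carried by the bits of slot `(a, b)`, as a function
  -- of the literal in that slot (read off the constant array)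
  set w : Fin (2 ^ j) → Fin m → Fin k → Fin (2 ^ j) × Bool → ℝ := fun v a b ℓ =>
    ∑ e ∈ univ.filter (fun e => litArrayBitSlot m k j e = (a, b)),
      c v e * (if bitsOfLitArray m k j (fun _ _ => ℓ) e then (1 : ℝ) else 0) with hw
  set g : Fin (2 ^ j) → (Fin m → Fin k → Fin (2 ^ j) × Bool) → Bool := fun v Φ =>
    decide (θ v < ∑ a, ∑ b, w v a b (Φ a b)) with hg
  have hmain := hn m hm w θ g (fun v Φ => rfl)
  -- the linear form in the bits of `Φ` is the additive statistic `Σ_{a,b} w v a b (Φ a b)`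
  have hlin : ∀ (v : Fin (2 ^ j)) (Φ : Fin m → Fin k → Fin (2 ^ j) × Bool),
      (∑ e, c v e * (if bitsOfLitArray m k j Φ e then (1 : ℝ) else 0)) =
        ∑ a, ∑ b, w v a b (Φ a b) := by
    intro v Φ
    simp only [hw]
    rw [← Fintype.sum_prod_type']
    symm
    calc ∑ p : Fin m × Fin k, ∑ e ∈ univ.filter (fun e => litArrayBitSlot m k j e = (p.1, p.2)),
          c v e * (if bitsOfLitArray m k j (fun _ _ => Φ p.1 p.2) e then (1 : ℝ) else 0)
        = ∑ p : Fin m × Fin k, ∑ e ∈ univ.filter (fun e => litArrayBitSlot m k j e = p),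
          c v e * (if bitsOfLitArray m k j Φ e then (1 : ℝ) else 0) := by
          refine sum_congr rfl fun p _ => ?_
          simp only [Prod.mk.eta]
          refine sum_congr rfl fun e he => ?_
          have hs : litArrayBitSlot m k j e = p := (mem_filter.1 he).2
          rw [bitsOfLitArray_eq_of_slot_eq (Φ := fun _ _ => Φ p.1 p.2) (Ψ := Φ) (by rw [hs])]
      _ = ∑ e, c v e * (if bitsOfLitArray m k j Φ e then (1 : ℝ) else 0) :=
          sum_fiberwise univ (litArrayBitSlot m k j) _
  -- the solved inputs `x` inject (via the encoding) into the instances solved by `g`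
  refine le_trans ?_ (hmain.trans_eq ?_)
  · refine Nat.cast_le.2 (Finset.card_le_card_of_injOn (litArrayOfBits m k j)
      (fun x hx => ?_) (fun x _ y _ hxy => litArrayOfBits_injective hxy))
    simp only [coe_filter, mem_univ, true_and, Set.mem_setOf_eq] at hx ⊢
    intro i
    obtain ⟨j', hj'⟩ := hx i
    refine ⟨j', ?_⟩
    rw [← hj', hg]
    refine decide_eq_decide.mpr ?_
    rw [← hlin, bitsOfLitArray_litArrayOfBits]
  · rw [card_litArray_two_pow]
    push_cast
    ring

end Summit.PneNP.PneNP.Theorems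

end
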